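import Summits.QuantumFields.YangMills.Theorems.BalabanUVNodesN15KingModelAnalyticDeterminantVolumeLawBlockField
import Summits.QuantumFields.YangMills.Theorems.BalabanUVNodesN15KingModelAnalyticDeterminantGreenDiagonalFour
import HarnessLib

/-!
# BalabanUVNodes ∕ N15 — THE KING-MODEL RUNG (PART Ϯ-f): THE η-UNIFORM VOLUME LAW IN FOUR DIMENSIONS — at King's scaling `c = L²` on the fine four-torus `(ℤ∕LM₀)⁴`, for unitary
# backgrounds that agree off the bond set `Z`: `|ln det Δ_eff(U) − ln det Δ_eff(V)| ≤ (10|n|² + (8|n|² + a|n|)∕m²)·#Z` for EVERY `L ≥ 1` (every spacing `η = L⁻¹`), EVERY volume `M₀`, every tree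
# contour system — PART Ϯ-d's volume law with PART Ϯ-e's coincident-point bound in its COARSE, volume-free form `L²·G(0,0) ≤ 5∕4 + 1∕m²` (`king_green_diag_eta_uniform'`; the sharp
# `5∕4 + 1∕(m²L²M₀⁴)` of `king_green_diag_eta_uniform` is not needed here); the same for the fine normalisation, the one with the block term, King's `E₀ = ln 𝒩`, and the deviation from
# King's closed form
# v1.1 (DOC-ONLY, ref-I READ-1098 N1): the title now quotes the coarse constant every theorem below uses; declarations byte-identical to v1.0 (p834052).
# (Track A, DAG node N15 = NE2 — «η-rates ∕ η-uniformity of the covariance pieces»; FAN-OUT v1.1 §N15 s3 «KING-MODEL RUNG … + what the curved case adds»; count-neutral)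

HONEST FRAMING.  Count-neutral (cell `pub-ymgap`, seat `pub-ymgap-dag-n15-e` g54; `--supports stmt-QuantumFields-27247 --as helper` = K3ᴬ, KEY MAP v3).  King's one-level comparison model on the
CUBIC fine four-torus `Tor (fine L (cM M₀))` (`d + 1 = 4`, equal periods), Bałaban's covariant block mean on a tree contour system `T : BlockTree 3 L`, King's scaling `c = L²` ((2.13) p.653),
`a > 0` (resp. `≥ 0`), `m² > 0`, unitary `U, V`, any fibre `𝕜ⁿ`.  One finite torus per spacing; «η-uniform» = the constant does not depend on `L`, `M₀` or `T`.  NOT King's multi-step `Z_k`;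
NOT Bałaban's (3.42); NOT a node discharge (N15 of record untouched); nothing continuum ∕ ℝ⁴ ∕ OS ∕ Clay.

CONTENT.  §1 `volumeConst_le` (`8|n|²·L²G(0,0) + a|n|∕m² ≤ 10|n|² + (8|n|² + a|n|)∕m²`); ★★★ `abs_log_re_det_covLapF_sub_le_volume_eta_uniform` (fine: `≤ 5|n|²·#Z + 4|n|²#Z∕m²`),
★★★ `abs_log_re_det_fullOpU_sub_le_volume_eta_uniform`, ★★★★ **`abs_log_re_det_effLapU_sub_le_volume_eta_uniform`** (NE2's unit layer), ★★★ `abs_log_re_det_effLapU_sub_closedForm_le_volume_eta_uniform`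
(deviation from King's closed form `|n|Σ_q ln effSym(q)` is `≤ (10|n|² + (8|n|²+a|n|)∕m²)·#supp`), ★★★ `abs_log_gaussNorm_effLapU_sub_le_volume_eta_uniform` (`ℝ`; half of it);
§2 ★★★★ **`king_volume_law_eta_uniform_package`**.

PRIOR TREE ART (by name, not restated): Ϯ-b∕c∕d (the volume laws with constant `c·G(0,0)`), Ϯ-e `king_green_diag_eta_uniform` (`L²G(x,x) ≤ 5∕4 + (m²L²M₀⁴)⁻¹`), Literature `Beta.WoodburyFibre.cM`.
Dedup (rg at filing): basename 0 files; `abs_log_re_det_effLapU_sub_le_volume_eta_uniform|abs_log_re_det_covLapF_sub_le_volume_eta_uniform|king_volume_law_eta_uniform_package` 0 tree files.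
Locators: [King1986] (2.13)–(2.16) p.653, (3.89)–(3.90) pp.668–669, (4.4)–(4.5) p.670, (4.33)∕(4.35) p.674; [Balaban1985BackgroundPropagators] (3.19) p.393, (3.23)–(3.25) p.394, (3.42) p.397.  0 `sorry`, 0 `def`.
-/

noncomputable section

open scoped BigOperators ComplexConjugate ComplexOrder Matrix.Norms.L2Operator
open Finset Matrix WithLp

namespace Summit.QuantumFields.YangMills.BalabanUVNodes.N15KingModelRung.Analytic

open Literature.MathematicalPhysics.QuantumFieldTheory.Balaban1983to89.B5Prop11Plancherel (Tor fine)
open Literature.MathematicalPhysics.QuantumFieldTheory.King1986.Torus (lapF effSym)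
open Literature.MathematicalPhysics.QuantumFieldTheory.Balaban1983to89.Beta.WoodburyFibre (cM)
open Summit.QuantumFields.YangMills.BalabanUVNodes.N15KingModelRung.Covariant (covLapF lapF_inv_entry_nonneg)
open Summit.QuantumFields.YangMills.BalabanUVNodes.N15KingModelRung.CovariantBlock (BlockTree fullOpU effLapU)
open Summit.QuantumFields.YangMills.BalabanUVNodes.N15KingModelRung.FreeField (gaussNorm)

variable {L : ℕ} [NeZero L] (T : BlockTree 3 L) (M₀ : ℕ) [NeZero M₀]

/-! ## §1 The η-uniform volume laws -/

section EtaUniform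

variable {𝕜 : Type*} [RCLike 𝕜] {n : Type*} [Fintype n] [DecidableEq n]
variable {a m2 : ℝ} (hm : 0 < m2)
include hm

omit [DecidableEq n] in
/-- THE CONSTANT: `8|n|²·L²G(0,0) + a|n|∕m² ≤ 10|n|² + (8|n|² + a|n|)∕m²` for every `L, M₀ ≥ 1` (Ϯ-e `king_green_diag_eta_uniform'`). [cite: King1986, (2.13) p.653, (4.4) p.670] -/
theorem volumeConst_le (a : ℝ) :
    8 * (L : ℝ) ^ 2 * (Fintype.card n : ℝ) ^ 2 * (lapF (fine L (cM M₀)) ((L : ℝ) ^ 2) m2)⁻¹ 0 0 + a * (Fintype.card n : ℝ) * m2⁻¹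
      ≤ 10 * (Fintype.card n : ℝ) ^ 2 + (8 * (Fintype.card n : ℝ) ^ 2 + a * (Fintype.card n : ℝ)) * m2⁻¹ := by
  have h := king_green_diag_eta_uniform' L M₀ hm (0 : Tor (fine L (cM M₀)))
  have hn : (0 : ℝ) ≤ (Fintype.card n : ℝ) ^ 2 := by positivity
  have e : 8 * (L : ℝ) ^ 2 * (Fintype.card n : ℝ) ^ 2 * (lapF (fine L (cM M₀)) ((L : ℝ) ^ 2) m2)⁻¹ 0 0
      = 8 * (Fintype.card n : ℝ) ^ 2 * ((L : ℝ) ^ 2 * (lapF (fine L (cM M₀)) ((L : ℝ) ^ 2) m2)⁻¹ 0 0) := by ring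
  rw [e]
  nlinarith [mul_le_mul_of_nonneg_left h hn]

variable {U V : Tor (fine L (cM M₀)) × Fin (3 + 1) → Matrix n n 𝕜} (hU : ∀ bd, U bd ∈ Matrix.unitaryGroup n 𝕜) (hV : ∀ bd, V bd ∈ Matrix.unitaryGroup n 𝕜)
include hU hV

/-- ★★★ **THE η-UNIFORM VOLUME LAW FOR THE FINE NORMALISATION** (`d+1 = 4`, `c = L²`): `|ln det(−L²Δ_U+m²) − ln det(−L²Δ_V+m²)| ≤ (5 + 4∕m²)|n|²·#Z` for backgrounds agreeing off `Z`,
every `L`, every volume. [cite: King1986, (2.13) p.653, (4.4) p.670, (4.35) p.674; Balaban1985BackgroundPropagators, (3.23) p.394, (3.42) p.397] -/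
theorem abs_log_re_det_covLapF_sub_le_volume_eta_uniform {Z : Finset (Tor (fine L (cM M₀)) × Fin (3 + 1))} (hZ : ∀ bd, bd ∉ Z → U bd = V bd) :
    |Real.log (RCLike.re (covLapF (fine L (cM M₀)) ((L : ℝ) ^ 2) m2 U).det) - Real.log (RCLike.re (covLapF (fine L (cM M₀)) ((L : ℝ) ^ 2) m2 V).det)|
      ≤ (5 + 4 * m2⁻¹) * (Fintype.card n : ℝ) ^ 2 * Z.card := by
  have h := abs_log_re_det_covLapF_sub_le_volume (fine L (cM M₀)) (c := (L : ℝ) ^ 2) (by positivity) hm hU hV hZ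
  have hg := king_green_diag_eta_uniform' L M₀ hm (0 : Tor (fine L (cM M₀)))
  have hn : (0 : ℝ) ≤ (Fintype.card n : ℝ) ^ 2 * Z.card := by positivity
  calc _ ≤ 4 * (L : ℝ) ^ 2 * (Fintype.card n : ℝ) ^ 2 * (lapF (fine L (cM M₀)) ((L : ℝ) ^ 2) m2)⁻¹ 0 0 * Z.card := h
    _ = 4 * ((L : ℝ) ^ 2 * (lapF (fine L (cM M₀)) ((L : ℝ) ^ 2) m2)⁻¹ 0 0) * ((Fintype.card n : ℝ) ^ 2 * Z.card) := by ring
    _ ≤ 4 * (5 / 4 + m2⁻¹) * ((Fintype.card n : ℝ) ^ 2 * Z.card) := mul_le_mul_of_nonneg_right (by linarith) hn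
    _ = (5 + 4 * m2⁻¹) * (Fintype.card n : ℝ) ^ 2 * Z.card := by ring

/-- ★★★ **THE η-UNIFORM VOLUME LAW WITH THE BLOCK TERM** (`a ≥ 0`): `|ln det A₀(U) − ln det A₀(V)| ≤ (5|n|² + (4|n|² + a|n|)∕m²)·#Z`, every `L`, every volume, every tree contour system.
[cite: King1986, (2.13) p.653, (4.4)–(4.5) p.670; Balaban1985BackgroundPropagators, (3.19) p.393, (3.23)–(3.25) p.394, (3.42) p.397] -/
theorem abs_log_re_det_fullOpU_sub_le_volume_eta_uniform (ha : 0 ≤ a) {Z : Finset (Tor (fine L (cM M₀)) × Fin (3 + 1))} (hZ : ∀ bd, bd ∉ Z → U bd = V bd) :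
    |Real.log (RCLike.re (fullOpU T (cM M₀) a ((L : ℝ) ^ 2) m2 U).det) - Real.log (RCLike.re (fullOpU T (cM M₀) a ((L : ℝ) ^ 2) m2 V).det)|
      ≤ (5 * (Fintype.card n : ℝ) ^ 2 + (4 * (Fintype.card n : ℝ) ^ 2 + a * (Fintype.card n : ℝ)) * m2⁻¹) * Z.card := by
  have h := abs_log_re_det_fullOpU_sub_le_volume T (cM M₀) ha (c := (L : ℝ) ^ 2) (by positivity) hm hU hV hZ
  have hg := king_green_diag_eta_uniform' L M₀ hm (0 : Tor (fine L (cM M₀)))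
  have hn : (0 : ℝ) ≤ (Fintype.card n : ℝ) ^ 2 := by positivity
  refine h.trans (mul_le_mul_of_nonneg_right ?_ (Nat.cast_nonneg _))
  have e : 4 * (L : ℝ) ^ 2 * (Fintype.card n : ℝ) ^ 2 * (lapF (fine L (cM M₀)) ((L : ℝ) ^ 2) m2)⁻¹ 0 0
      = 4 * (Fintype.card n : ℝ) ^ 2 * ((L : ℝ) ^ 2 * (lapF (fine L (cM M₀)) ((L : ℝ) ^ 2) m2)⁻¹ 0 0) := by ring
  rw [e]
  nlinarith [mul_le_mul_of_nonneg_left hg hn]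

/-- ★★★★ **THE η-UNIFORM VOLUME LAW FOR NE2's UNIT-LAYER NORMALISATION** (`d+1 = 4`, King's scaling `c = L²`, `a > 0`, `m² > 0`): for unitary backgrounds that agree off the bond set `Z`,
`|ln det Δ_eff(U) − ln det Δ_eff(V)| ≤ (10|n|² + (8|n|² + a|n|)∕m²)·#Z` for EVERY `L ≥ 1`, EVERY volume `M₀`, EVERY tree contour system — King's `ln[Z(U)Z(V)⁻¹]` of the block-field
normalisation is local in the background with a constant that does not see the spacing `η = L⁻¹` (Ϯ-d + Ϯ-e: the 4-d walk is transient).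
[cite: King1986, (2.13)–(2.14) p.653, (3.89)–(3.90) pp.668–669, (4.4)–(4.5) p.670, (4.33) p.674; Balaban1985BackgroundPropagators, (3.19) p.393, (3.23)–(3.25) p.394, (3.42) p.397] -/
theorem abs_log_re_det_effLapU_sub_le_volume_eta_uniform (ha : 0 < a) {Z : Finset (Tor (fine L (cM M₀)) × Fin (3 + 1))} (hZ : ∀ bd, bd ∉ Z → U bd = V bd) :
    |Real.log (RCLike.re (effLapU T (cM M₀) a ((L : ℝ) ^ 2) m2 U).det) - Real.log (RCLike.re (effLapU T (cM M₀) a ((L : ℝ) ^ 2) m2 V).det)|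
      ≤ (10 * (Fintype.card n : ℝ) ^ 2 + (8 * (Fintype.card n : ℝ) ^ 2 + a * (Fintype.card n : ℝ)) * m2⁻¹) * Z.card :=
  (abs_log_re_det_effLapU_sub_le_volume T (cM M₀) ha (c := (L : ℝ) ^ 2) (by positivity) hm hU hV hZ).trans
    (mul_le_mul_of_nonneg_right (volumeConst_le M₀ hm a) (Nat.cast_nonneg _))

omit hV in
/-- ★★★ **THE η-UNIFORM DEVIATION FROM KING's CLOSED FORM**: a unitary background trivial off `Z` satisfies
`|ln det Δ_eff(U) − |n|·Σ_q ln effSym(q)| ≤ (10|n|² + (8|n|² + a|n|)∕m²)·#Z`, every `L ≥ 1`, every volume — WHAT THE CURVED CASE ADDS to King's (2.14)–(2.16), quantified uniformly in `η`.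
[cite: King1986, (2.14)–(2.16) p.653, (3.89)–(3.90) pp.668–669, (4.33)∕(4.35) p.674; Balaban1985BackgroundPropagators, (3.19) p.393, (3.42) p.397] -/
theorem abs_log_re_det_effLapU_sub_closedForm_le_volume_eta_uniform (ha : 0 < a) {Z : Finset (Tor (fine L (cM M₀)) × Fin (3 + 1))} (hZ : ∀ bd, bd ∉ Z → U bd = 1) :
    |Real.log (RCLike.re (effLapU T (cM M₀) a ((L : ℝ) ^ 2) m2 U).det) - Fintype.card n * ∑ q : Tor (cM M₀), Real.log (effSym L (cM M₀) a ((L : ℝ) ^ 2) m2 q)|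
      ≤ (10 * (Fintype.card n : ℝ) ^ 2 + (8 * (Fintype.card n : ℝ) ^ 2 + a * (Fintype.card n : ℝ)) * m2⁻¹) * Z.card :=
  (abs_log_re_det_effLapU_sub_closedForm_le_volume T (cM M₀) (Nat.one_le_iff_ne_zero.mpr (NeZero.ne L)) ha hm hU hZ).trans
    (mul_le_mul_of_nonneg_right (volumeConst_le M₀ hm a) (Nat.cast_nonneg _))

end EtaUniform

/-! ## §1′ King's `E₀ = ln 𝒩(Δ_eff)` (`𝕜 = ℝ`) -/

section Gauss

variable {n : Type*} [Fintype n] [DecidableEq n] [Nonempty n]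
variable {a m2 : ℝ} (ha : 0 < a) (hm : 0 < m2)
variable {U V : Tor (fine L (cM M₀)) × Fin (3 + 1) → Matrix n n ℝ} (hU : ∀ bd, U bd ∈ Matrix.unitaryGroup n ℝ) (hV : ∀ bd, V bd ∈ Matrix.unitaryGroup n ℝ)
include ha hm hU hV

/-- ★★★ **THE η-UNIFORM VOLUME LAW FOR KING's (3.89) NORMALISATION**: `|ln 𝒩(Δ_eff(U)) − ln 𝒩(Δ_eff(V))| ≤ ½(10|n|² + (8|n|² + a|n|)∕m²)·#Z`, every `L`, every volume.
[cite: King1986, (2.6) p.652, (3.89)–(3.90) pp.668–669, (4.33) p.674] -/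
theorem abs_log_gaussNorm_effLapU_sub_le_volume_eta_uniform {Z : Finset (Tor (fine L (cM M₀)) × Fin (3 + 1))} (hZ : ∀ bd, bd ∉ Z → U bd = V bd) :
    |Real.log (gaussNorm (effLapU T (cM M₀) a ((L : ℝ) ^ 2) m2 U)) - Real.log (gaussNorm (effLapU T (cM M₀) a ((L : ℝ) ^ 2) m2 V))|
      ≤ 1 / 2 * ((10 * (Fintype.card n : ℝ) ^ 2 + (8 * (Fintype.card n : ℝ) ^ 2 + a * (Fintype.card n : ℝ)) * m2⁻¹) * Z.card) :=
  (abs_log_gaussNorm_effLapU_sub_le_volume T (cM M₀) ha (c := (L : ℝ) ^ 2) (by positivity) hm hU hV hZ).trans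
    (mul_le_mul_of_nonneg_left (mul_le_mul_of_nonneg_right (volumeConst_le M₀ hm a) (Nat.cast_nonneg _)) (by norm_num))

end Gauss

/-! ## §2 Package -/

section Package

variable {𝕜 : Type*} [RCLike 𝕜] {n : Type*} [Fintype n] [DecidableEq n]
variable {a m2 : ℝ} (ha : 0 < a) (hm : 0 < m2)
variable {U V : Tor (fine L (cM M₀)) × Fin (3 + 1) → Matrix n n 𝕜} (hU : ∀ bd, U bd ∈ Matrix.unitaryGroup n 𝕜) (hV : ∀ bd, V bd ∈ Matrix.unitaryGroup n 𝕜)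
include ha hm hU hV

/-- ★★★★ **THE η-UNIFORM VOLUME LAW, PACKAGED** (`d+1 = 4`, `c = L²`, every `L, M₀ ≥ 1`, every tree contour system; backgrounds agreeing off `Z`): (i) fine `≤ (5 + 4∕m²)|n|²·#Z`;
(ii) with the block term `≤ (5|n|² + (4|n|²+a|n|)∕m²)·#Z`; (iii) NE2's unit layer `≤ (10|n|² + (8|n|²+a|n|)∕m²)·#Z`; (iv) the coincident-point bound that makes it uniform: `L²·G(0,0) ≤ 5∕4 + 1∕m²`.
[cite: King1986, (2.13)–(2.14) p.653, (3.89)–(3.90) pp.668–669, (4.4)–(4.5) p.670, (4.35) p.674; Balaban1985BackgroundPropagators, (3.19) p.393, (3.23)–(3.25) p.394, (3.42) p.397] -/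
theorem king_volume_law_eta_uniform_package {Z : Finset (Tor (fine L (cM M₀)) × Fin (3 + 1))} (hZ : ∀ bd, bd ∉ Z → U bd = V bd) :
    |Real.log (RCLike.re (covLapF (fine L (cM M₀)) ((L : ℝ) ^ 2) m2 U).det) - Real.log (RCLike.re (covLapF (fine L (cM M₀)) ((L : ℝ) ^ 2) m2 V).det)|
        ≤ (5 + 4 * m2⁻¹) * (Fintype.card n : ℝ) ^ 2 * Z.card
    ∧ |Real.log (RCLike.re (fullOpU T (cM M₀) a ((L : ℝ) ^ 2) m2 U).det) - Real.log (RCLike.re (fullOpU T (cM M₀) a ((L : ℝ) ^ 2) m2 V).det)|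
        ≤ (5 * (Fintype.card n : ℝ) ^ 2 + (4 * (Fintype.card n : ℝ) ^ 2 + a * (Fintype.card n : ℝ)) * m2⁻¹) * Z.card
    ∧ |Real.log (RCLike.re (effLapU T (cM M₀) a ((L : ℝ) ^ 2) m2 U).det) - Real.log (RCLike.re (effLapU T (cM M₀) a ((L : ℝ) ^ 2) m2 V).det)|
        ≤ (10 * (Fintype.card n : ℝ) ^ 2 + (8 * (Fintype.card n : ℝ) ^ 2 + a * (Fintype.card n : ℝ)) * m2⁻¹) * Z.card
    ∧ (L : ℝ) ^ 2 * (lapF (fine L (cM M₀)) ((L : ℝ) ^ 2) m2)⁻¹ 0 0 ≤ 5 / 4 + m2⁻¹ :=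
  ⟨abs_log_re_det_covLapF_sub_le_volume_eta_uniform M₀ hm hU hV hZ, abs_log_re_det_fullOpU_sub_le_volume_eta_uniform T M₀ hm hU hV ha.le hZ,
    abs_log_re_det_effLapU_sub_le_volume_eta_uniform T M₀ hm hU hV ha hZ, king_green_diag_eta_uniform' L M₀ hm 0⟩

end Package

end Summit.QuantumFields.YangMills.BalabanUVNodes.N15KingModelRung.Analytic

end
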